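import Literature.Computability.AlgebraicComplexity.IK2020YoungWreathAverage
import Literature.Computability.AlgebraicComplexity.IK2020Prop101Holds
import Literature.NumberTheory.DiophantineGeometry.PartitionDominance
import HarnessLib

/-!
# The block word of content `D·ϱ̂` and its stabilizer (brick W1 of the `val-lit` route to
# Ikenmeyer–Kandasamy 2020, Prop. 10.1)

C. Ikenmeyer, U. Kandasamy, *Implementing geometric complexity theory: on the separation of orbit
closures via symmetries*, STOC 2020 = arXiv:1911.03990 [IkenmeyerKandasamy2019], §10, proof of
Prop. 10.1: "`({λ}^{Dϱ})^{stab ϱ}` … the stabilizer of the weight vector `Dϱ` … is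
`∏ᵢ 𝔖_{ρ̂ᵢ} ≀ 𝔖_{iD}`". In the word model of the tree (`IK2020ContentSliceTransport.lean`,
`YoungWreathSliceCharacter.lean`) this is the statement that for a suitable word `w₀` of content
`γ = D·ϱ̂` on the positions `Fin (∑ᵢ nᵢ)`, `nᵢ = D·(i+1)·ρ̂_{i+1}` (the block sizes of `IK2020.bCoeff`),
the subgroup `K_γ(w₀) = {τ ∈ 𝔖_n | ∃ σ ∈ 𝔖_m, σ ∘ w₀ ∘ τ = w₀}` is the image under the Young embedding
`ψ : ∏ᵢ 𝔖_{nᵢ} → 𝔖_n` of the product of the wreath products `𝔖_{ρ̂_{i+1}} ≀ 𝔖_{(i+1)D}` (the tree's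
`blockPerms`, transported to `Fin (nᵢ)` along `finCongr`).

Contents (theorems + plumbing definitions; no named facts):
* `youngEmbedding_apply_finSigmaFinEquiv`, `mem_range_youngEmbedding_iff` — the Young embedding
  `ψ = (permCongrHom finSigmaFinEquiv) ∘ sigmaCongrRightHom` maps `(i, p) ↦ (i, yᵢ p)`, and a
  permutation of `Fin (∑ nᵢ)` lies in its range iff it preserves the blocks;
* `IK2020.blockSubgroup` — `𝔖_{ρ̂_{i+1}} ≀ 𝔖_{(i+1)D}` inside `𝔖_{nᵢ}`; `IK2020.letterEquiv` — the
  letters `j` with `ϱ_j ≠ 0` enumerated block by block; `IK2020.blockWord` — the word `w₀`;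
* `IK2020.wordContent_blockWord` (`content(w₀) = D·ϱ̂`), `IK2020.exists_perm_comp_blockWord_iff`
  (`K_{Dϱ}(w₀) = ψ(∏ Kᵢ)`), packaged as `IK2020.exists_blockWord` (W1), and the per-block average
  `IK2020.card_inv_mul_sum_blockSubgroup_spechtCharacter` (W2 for these `Kᵢ`).

Honest framing: combinatorial bookkeeping for the `val-lit` cell (row IK20, U1); nothing here bears
on VP versus VNP.

## References

* [IkenmeyerKandasamy2019] C. Ikenmeyer, U. Kandasamy, STOC 2020 / arXiv:1911.03990, §10 Prop. 10.1
  (proof) and §3 (frequency notation `ρ̂`).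
* [BurgisserIkenmeyerPanovaJAMS2019] P. Bürgisser, C. Ikenmeyer, G. Panova, JAMS 32 (2019), §4 (the
  wreath product `𝔖_d ≀ 𝔖_n` as block-preserving permutations).
-/

noncomputable section

open scoped BigOperators
open Literature.NumberTheory.DiophantineGeometry

namespace Literature.Computability.AlgebraicComplexity

/-! ### The Young embedding `∏ᵢ 𝔖_{nᵢ} → 𝔖_{∑ nᵢ}` and its range -/

section YoungEmbedding

variable {d : ℕ} (n : Fin d → ℕ)

/-- The Young embedding `ψ = (permCongrHom finSigmaFinEquiv) ∘ sigmaCongrRightHom` (the composite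
inside `IK2020.blockPermHom`) acts blockwise: `ψ(y)(i, p) = (i, yᵢ p)` in the coordinates
`finSigmaFinEquiv : (Σ i, Fin (nᵢ)) ≃ Fin (∑ nᵢ)`. [cite: IkenmeyerKandasamy2019, §3] -/
theorem youngEmbedding_apply_finSigmaFinEquiv (y : ∀ i, Equiv.Perm (Fin (n i))) (i : Fin d)
    (p : Fin (n i)) :
    ((Equiv.permCongrHom (finSigmaFinEquiv (n := n))).toMonoidHom.comp
        (Equiv.Perm.sigmaCongrRightHom fun j => Fin (n j))) y (finSigmaFinEquiv ⟨i, p⟩) =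
      finSigmaFinEquiv ⟨i, y i p⟩ := by
  change finSigmaFinEquiv (Equiv.Perm.sigmaCongrRight y
    (finSigmaFinEquiv.symm (finSigmaFinEquiv ⟨i, p⟩))) = _
  rw [Equiv.symm_apply_apply]
  rfl

/-- A point of `Σ j, Fin (n j)` over `i` is `(i, ·)` of its (cast) second component. [folklore] -/
private theorem sigma_mk_cast_eq {x : Σ j, Fin (n j)} {i : Fin d} (hx : x.1 = i) :
    (⟨i, Fin.cast (congrArg n hx) x.2⟩ : Σ j, Fin (n j)) = x := by
  obtain ⟨j, q⟩ := x
  cases hx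
  rfl

/-- **The range of the Young embedding is the set of block-preserving permutations**: a
permutation `τ` of `Fin (∑ nᵢ)` is of the form `ψ(y)` iff it maps every block into itself
(`(finSigmaFinEquiv⁻¹ (τ q)).1 = (finSigmaFinEquiv⁻¹ q).1`). [cite: IkenmeyerKandasamy2019, §3] -/
theorem mem_range_youngEmbedding_iff (τ : Equiv.Perm (Fin (∑ j, n j))) :
    τ ∈ ((Equiv.permCongrHom (finSigmaFinEquiv (n := n))).toMonoidHom.comp
        (Equiv.Perm.sigmaCongrRightHom fun j => Fin (n j))).range ↔
      ∀ q, (finSigmaFinEquiv.symm (τ q)).1 = (finSigmaFinEquiv.symm q).1 := by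
  constructor
  · rintro ⟨y, rfl⟩ q
    obtain ⟨⟨i, p⟩, rfl⟩ := (finSigmaFinEquiv (n := n)).surjective q
    rw [youngEmbedding_apply_finSigmaFinEquiv, Equiv.symm_apply_apply, Equiv.symm_apply_apply]
  · intro h
    set e := (finSigmaFinEquiv (n := n)) with he
    set τ' : Equiv.Perm (Σ j, Fin (n j)) := e.symm.permCongr τ with hτ'def
    have hτ' : ∀ x, (τ' x).1 = x.1 := fun x => by
      have hx := h (e x)
      rw [Equiv.symm_apply_apply] at hx
      exact hx
    let fib : ∀ i : Fin d, {x : Σ j, Fin (n j) // x.1 = i} ≃ Fin (n i) := fun i =>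
      { toFun := fun x => Fin.cast (congrArg n x.2) x.1.2
        invFun := fun p => ⟨⟨i, p⟩, rfl⟩
        left_inv := by
          rintro ⟨⟨j, q⟩, hj⟩
          cases hj
          rfl
        right_inv := fun p => rfl }
    let y : ∀ i, Equiv.Perm (Fin (n i)) := fun i =>
      ((fib i).symm.trans (τ'.subtypePerm fun x => by rw [hτ' x])).trans (fib i)
    refine ⟨y, Equiv.ext fun q => ?_⟩
    obtain ⟨⟨i, p⟩, rfl⟩ := e.surjective q
    rw [youngEmbedding_apply_finSigmaFinEquiv]
    have h1 : τ (e ⟨i, p⟩) = e (τ' ⟨i, p⟩) := by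
      rw [hτ'def, Equiv.permCongr_apply, Equiv.symm_symm, Equiv.apply_symm_apply]
    rw [h1]
    congr 1
    exact sigma_mk_cast_eq n (hτ' ⟨i, p⟩)

end YoungEmbedding

/-! ### Block sizes, block subgroups `𝔖_{ρ̂_{i+1}} ≀ 𝔖_{(i+1)D} ≤ 𝔖_{nᵢ}` and sub-block indices -/

namespace IK2020

section Blocks

variable {d : ℕ} (D : ℕ) (ρ : Nat.Partition d)

/-- The block sizes `nᵢ = D·(i+1)·ρ̂_{i+1}` of `IK2020.bCoeff` (`ρ̂ = freq ρ`): the number of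
positions of the word carrying a letter `j` with `ϱ_j = i+1`. [cite: IkenmeyerKandasamy2019, §10 (proof of Prop. 10.1)] -/
abbrev blockSize (i : Fin d) : ℕ := D * (i.1 + 1) * freq ρ (i.1 + 1)

/-- `ρ̂_{i+1} · ((i+1)·D) = nᵢ` (the `f × M` format of `blockPerms`). [cite: IkenmeyerKandasamy2019, §10 (proof of Prop. 10.1)] -/
theorem freq_mul_eq_blockSize (i : Fin d) :
    freq ρ (i.1 + 1) * ((i.1 + 1) * D) = blockSize D ρ i := by
  unfold blockSize
  ring

/-- **The block subgroup `Kᵢ = 𝔖_{ρ̂_{i+1}} ≀ 𝔖_{(i+1)D} ≤ 𝔖_{nᵢ}`**: the tree's wreath product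
`blockPerms (ρ̂_{i+1}) ((i+1)D)` (permutations of `ρ̂_{i+1}` sub-blocks of size `(i+1)D` mapping
sub-blocks to sub-blocks) transported to `Fin (nᵢ)` along `finCongr`. IK §10: "the stabilizer …
is `∏ᵢ 𝔖_{ρ̂ᵢ} ≀ 𝔖_{iD}`". [cite: IkenmeyerKandasamy2019, §10 (proof of Prop. 10.1)] -/
abbrev blockSubgroup (i : Fin d) : Subgroup (Equiv.Perm (Fin (blockSize D ρ i))) :=
  (blockPerms (freq ρ (i.1 + 1)) ((i.1 + 1) * D)).map
    (Equiv.permCongrHom (finCongr (freq_mul_eq_blockSize D ρ i))).toMonoidHom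

/-- The sub-block index `∈ Fin (ρ̂_{i+1})` of a position of block `i` (through `finCongr` and the
tree's `blockIdx`). [cite: IkenmeyerKandasamy2019, §10 (proof of Prop. 10.1)] -/
def subIdx (i : Fin d) (p : Fin (blockSize D ρ i)) : Fin (freq ρ (i.1 + 1)) :=
  blockIdx (freq ρ (i.1 + 1)) ((i.1 + 1) * D) ((finCongr (freq_mul_eq_blockSize D ρ i)).symm p)

/-- Membership in the block subgroup: `τ ∈ Kᵢ` iff `τ` maps sub-blocks to sub-blocks.
[cite: BurgisserIkenmeyerPanovaJAMS2019, §4] -/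
theorem mem_blockSubgroup_iff (i : Fin d) (τ : Equiv.Perm (Fin (blockSize D ρ i))) :
    τ ∈ blockSubgroup D ρ i ↔
      ∀ p p', subIdx D ρ i (τ p) = subIdx D ρ i (τ p') ↔ subIdx D ρ i p = subIdx D ρ i p' := by
  unfold blockSubgroup subIdx
  set c := finCongr (freq_mul_eq_blockSize D ρ i)
  rw [Subgroup.mem_map_equiv, mem_blockPerms]
  change (∀ q q', blockIdx _ _ (c.symm (τ (c q))) = blockIdx _ _ (c.symm (τ (c q'))) ↔
      blockIdx _ _ q = blockIdx _ _ q') ↔ _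
  constructor
  · intro h p p'
    have h' := h (c.symm p) (c.symm p')
    simp only [Equiv.apply_symm_apply] at h'
    exact h'
  · intro h q q'
    have h' := h (c q) (c q')
    simp only [Equiv.symm_apply_apply] at h'
    exact h'

/-- A representative position of sub-block `r` of block `i` (needs a nonempty sub-block, `0 < D`).
[folklore] -/
def subRep (hD : 0 < D) (i : Fin d) (r : Fin (freq ρ (i.1 + 1))) : Fin (blockSize D ρ i) :=
  finCongr (freq_mul_eq_blockSize D ρ i)
    (finProdFinEquiv (r, (⟨0, Nat.mul_pos (Nat.succ_pos _) hD⟩ : Fin ((i.1 + 1) * D))))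

/-- The representative of sub-block `r` lies in sub-block `r`. [cite: BurgisserIkenmeyerPanovaJAMS2019, §4] -/
@[simp]
theorem subIdx_subRep (hD : 0 < D) (i : Fin d) (r : Fin (freq ρ (i.1 + 1))) :
    subIdx D ρ i (subRep D ρ hD i r) = r := by
  simp [subIdx, subRep]

/-- The sub-block `r` of block `i` has `(i+1)·D` positions (blocks `B_u` of size `n`, BIP §4).
[cite: BurgisserIkenmeyerPanovaJAMS2019, §4] -/
theorem card_filter_subIdx_eq (i : Fin d) (r : Fin (freq ρ (i.1 + 1))) :
    (Finset.univ.filter fun p : Fin (blockSize D ρ i) => subIdx D ρ i p = r).card = (i.1 + 1) * D := by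
  set c := finCongr (freq_mul_eq_blockSize D ρ i) with hc
  have h : (Finset.univ.filter fun p : Fin (blockSize D ρ i) => subIdx D ρ i p = r).card =
      Fintype.card (Fin ((i.1 + 1) * D)) := by
    rw [← Fintype.card_subtype]
    refine Fintype.card_congr
      { toFun := fun p => (finProdFinEquiv.symm (c.symm p.1)).2
        invFun := fun s => ⟨c (finProdFinEquiv (r, s)), by simp [subIdx, hc]⟩
        left_inv := ?_
        right_inv := ?_ }
    · rintro ⟨p, hp⟩
      apply Subtype.ext
      simp only [subIdx, blockIdx] at hp
      change c (finProdFinEquiv (r, (finProdFinEquiv.symm (c.symm p)).2)) = p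
      rw [← hp, Prod.mk.eta, Equiv.apply_symm_apply, Equiv.apply_symm_apply]
    · intro s
      simp
  rw [h, Fintype.card_fin]

end Blocks

/-! ### Letters: `{j : Fin m | ϱ_j ≠ 0}` enumerated block by block -/

section Letters

variable {d : ℕ} (m : ℕ) (ρ : Nat.Partition d)

/-- The zero-padded parts are bounded by the size. [folklore] -/
private theorem getD_sortedParts_le' (j : ℕ) : ρ.sortedParts.getD j 0 ≤ d := by
  by_cases hj : j < ρ.sortedParts.length
  · rw [List.getD_eq_getElem _ _ hj]
    have hmem : ρ.sortedParts[j] ∈ ρ.parts := (Multiset.mem_sort _).mp (List.getElem_mem hj)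
    calc ρ.sortedParts[j] ≤ ρ.parts.sum := Multiset.le_sum_of_mem hmem
      _ = d := ρ.parts_sum
  · rw [List.getD_eq_default _ _ (not_lt.1 hj)]
    exact Nat.zero_le _

/-- A nonzero zero-padded part sits at an index below the number of parts. [folklore] -/
private theorem lt_length_of_getD_ne_zero {j : ℕ} (h : ρ.sortedParts.getD j 0 ≠ 0) :
    j < ρ.sortedParts.length := by
  by_contra hj
  exact h (List.getD_eq_default _ _ (not_lt.1 hj))

/-- **`#{j < m : ϱ_j = v} = ρ̂_v`** for `v ≠ 0` and `ℓ(ϱ) ≤ m`: among the first `m` zero-padded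
parts, the value `v` occurs `freq ρ v` times (IK §3: "`ρ̂_i := |{j | ϱ_j = i}|`").
[cite: IkenmeyerKandasamy2019, §3] -/
theorem card_filter_getD_eq_freq (hρ : ρ.parts.card ≤ m) {v : ℕ} (hv : v ≠ 0) :
    (Finset.univ.filter fun j : Fin m => ρ.sortedParts.getD j 0 = v).card = freq ρ v := by
  rw [freq, ← card_univ_filter_sortedParts_getD_eq_count ρ v]
  have hL : ρ.sortedParts.length ≤ m := by rw [Nat.Partition.length_sortedParts]; exact hρ
  refine Finset.card_bij'
    (fun j hj => ⟨j.1, lt_length_of_getD_ne_zero ρ (by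
      rw [(Finset.mem_filter.mp hj).2]; exact hv)⟩)
    (fun i _ => ⟨i.1, lt_of_lt_of_le i.2 hL⟩) ?_ ?_ ?_ ?_
  · intro j hj
    simpa using hj
  · intro i hi
    simpa using hi
  · intro j _
    rfl
  · intro i _
    rfl

/-- The value-class map of a letter with `ϱ_j ≠ 0`: `j ↦ ϱ_j - 1 ∈ Fin d`. [folklore] -/
def letterBlock (j : {j : Fin m // ρ.sortedParts.getD j 0 ≠ 0}) : Fin d :=
  ⟨ρ.sortedParts.getD j.1 0 - 1, by
    have h1 := getD_sortedParts_le' ρ j.1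
    have h2 : 0 < ρ.sortedParts.getD j.1 0 := Nat.pos_of_ne_zero j.2
    omega⟩

/-- `letterBlock j = i ↔ ϱ_j = i + 1` (frequency notation, IK §3). [cite: IkenmeyerKandasamy2019, §3] -/
theorem letterBlock_eq_iff (j : {j : Fin m // ρ.sortedParts.getD j 0 ≠ 0}) (i : Fin d) :
    letterBlock m ρ j = i ↔ ρ.sortedParts.getD j.1 0 = i.1 + 1 := by
  rw [letterBlock, Fin.ext_iff]
  have h2 : 0 < ρ.sortedParts.getD j.1 0 := Nat.pos_of_ne_zero j.2
  simp only
  omega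

/-- The fibre of `Sigma.fst` over `c` in `Σ i, Fin (F i)` is `Fin (F c)`. [folklore] -/
def sigmaFinFiberEquiv (F : Fin d → ℕ) (c : Fin d) : {x : Σ i, Fin (F i) // x.1 = c} ≃ Fin (F c) where
  toFun x := Fin.cast (congrArg F x.2) x.1.2
  invFun p := ⟨⟨c, p⟩, rfl⟩
  left_inv := by
    rintro ⟨⟨j, q⟩, hj⟩
    cases hj
    rfl
  right_inv p := rfl

variable {m} in
/-- The two fibres over a block index have the same size `ρ̂_{c+1}`. [folklore] -/
private theorem card_fiber_eq (hρ : ρ.parts.card ≤ m) (c : Fin d) :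
    Fintype.card {x : Σ i : Fin d, Fin (freq ρ (i.1 + 1)) // x.1 = c} =
      Fintype.card {j : {j : Fin m // ρ.sortedParts.getD j 0 ≠ 0} // letterBlock m ρ j = c} := by
  classical
  rw [Fintype.card_congr (sigmaFinFiberEquiv (fun i : Fin d => freq ρ (i.1 + 1)) c),
    Fintype.card_fin]
  have e : {j : {j : Fin m // ρ.sortedParts.getD j 0 ≠ 0} // letterBlock m ρ j = c} ≃
      {j : Fin m // ρ.sortedParts.getD j 0 = c.1 + 1} :=
    (Equiv.subtypeEquivRight fun j => letterBlock_eq_iff m ρ j c).trans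
      (Equiv.subtypeSubtypeEquivSubtype (p := fun j : Fin m => ρ.sortedParts.getD j 0 ≠ 0)
        (q := fun j : Fin m => ρ.sortedParts.getD j 0 = c.1 + 1) fun {j} h => by
          rw [show ρ.sortedParts.getD j 0 = c.1 + 1 from h]
          exact Nat.succ_ne_zero _)
  rw [Fintype.card_congr e, Fintype.card_subtype, card_filter_getD_eq_freq m ρ hρ (Nat.succ_ne_zero _)]

/-- **The letter equivalence**: the pairs `(i, r)`, `i < d`, `r < ρ̂_{i+1}`, enumerate the letters
`j < m` with `ϱ_j ≠ 0`, block `i` going to the letters with `ϱ_j = i + 1` (for `ℓ(ϱ) ≤ m`).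
[cite: IkenmeyerKandasamy2019, §10 (proof of Prop. 10.1)] -/
def letterEquiv (hρ : ρ.parts.card ≤ m) :
    (Σ i : Fin d, Fin (freq ρ (i.1 + 1))) ≃ {j : Fin m // ρ.sortedParts.getD j 0 ≠ 0} :=
  Equiv.ofFiberEquiv (f := Sigma.fst) (g := letterBlock m ρ)
    fun c => Fintype.equivOfCardEq (card_fiber_eq ρ hρ c)

/-- The letter `Λ(i, r)` has `ϱ = i + 1`. [cite: IkenmeyerKandasamy2019, §10 (proof of Prop. 10.1)] -/
theorem getD_letterEquiv (hρ : ρ.parts.card ≤ m) (x : Σ i : Fin d, Fin (freq ρ (i.1 + 1))) :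
    ρ.sortedParts.getD (letterEquiv m ρ hρ x : Fin m) 0 = x.1.1 + 1 := by
  have h := Equiv.ofFiberEquiv_map (f := Sigma.fst) (g := letterBlock m ρ)
    (fun c => Fintype.equivOfCardEq (card_fiber_eq ρ hρ c)) x
  exact (letterBlock_eq_iff m ρ _ _).mp h

end Letters

/-! ### The block word and its content -/

section BlockWord

variable {d : ℕ} (m D : ℕ) (ρ : Nat.Partition d) (hρ : ρ.parts.card ≤ m)

/-- **The block word `w₀`** on the positions `Fin (∑ᵢ nᵢ)`: position `(i, p)` (block `i`, via
`finSigmaFinEquiv`) carries the letter `Λ(i, subIdx p)` — sub-block `r` of block `i` is filled with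
the `r`-th letter `j` having `ϱ_j = i + 1`, so that the letter `j` occurs `(i+1)·D = D·ϱ_j` times.
[cite: IkenmeyerKandasamy2019, §10 (proof of Prop. 10.1)] -/
def blockWord : Word m (∑ j, blockSize D ρ j) := fun q =>
  (letterEquiv m ρ hρ ⟨(finSigmaFinEquiv.symm q).1, subIdx D ρ _ (finSigmaFinEquiv.symm q).2⟩ : Fin m)

/-- The block word in block coordinates. [cite: IkenmeyerKandasamy2019, §10 (proof of Prop. 10.1)] -/
theorem blockWord_apply (i : Fin d) (p : Fin (blockSize D ρ i)) :
    blockWord m D ρ hρ (finSigmaFinEquiv ⟨i, p⟩) = (letterEquiv m ρ hρ ⟨i, subIdx D ρ i p⟩ : Fin m) := by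
  unfold blockWord
  rw [Equiv.symm_apply_apply]

/-- Every letter of the block word has `ϱ ≠ 0`; its value class is the block.
[cite: IkenmeyerKandasamy2019, §10 (proof of Prop. 10.1)] -/
theorem getD_blockWord (i : Fin d) (p : Fin (blockSize D ρ i)) :
    ρ.sortedParts.getD (blockWord m D ρ hρ (finSigmaFinEquiv ⟨i, p⟩)) 0 = i.1 + 1 := by
  rw [blockWord_apply, getD_letterEquiv]

/-- **`content(w₀) = D·ϱ̂`**: the letter `j < m` occurs `D·ϱ_j` times in the block word.
[cite: IkenmeyerKandasamy2019, §10 (proof of Prop. 10.1)] -/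
theorem wordContent_blockWord :
    wordContent (blockWord m D ρ hρ) = fun j : Fin m => D * ρ.sortedParts.getD j 0 := by
  classical
  funext j
  unfold wordContent
  -- count in block coordinates
  rw [← Finset.card_map finSigmaFinEquiv.symm.toEmbedding]
  have hset : (Finset.univ.filter fun q : Fin (∑ j, blockSize D ρ j) => blockWord m D ρ hρ q = j).map
      finSigmaFinEquiv.symm.toEmbedding =
      Finset.univ.filter fun x : Σ i : Fin d, Fin (blockSize D ρ i) =>
        (letterEquiv m ρ hρ ⟨x.1, subIdx D ρ x.1 x.2⟩ : Fin m) = j := by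
    ext x
    simp only [Finset.mem_map_equiv, Finset.mem_filter, Finset.mem_univ, true_and,
      Equiv.symm_symm]
    obtain ⟨i, p⟩ := x
    rw [blockWord_apply]
  rw [hset]
  by_cases hj : ρ.sortedParts.getD j 0 = 0
  · -- no position carries a letter with `ϱ_j = 0`
    rw [hj, mul_zero, Finset.card_eq_zero, Finset.filter_eq_empty_iff]
    rintro ⟨i, p⟩ - h
    have := getD_letterEquiv m ρ hρ ⟨i, subIdx D ρ i p⟩
    rw [h, hj] at this
    exact Nat.succ_ne_zero _ this.symm
  · -- `j = Λ(i₀, r₀)`; the positions are the sub-block `r₀` of block `i₀`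
    obtain ⟨x₀, hx₀⟩ := (letterEquiv m ρ hρ).surjective ⟨j, hj⟩
    obtain ⟨i₀, r₀⟩ := x₀
    have hval : ρ.sortedParts.getD j 0 = i₀.1 + 1 := by
      have := getD_letterEquiv m ρ hρ ⟨i₀, r₀⟩
      rwa [hx₀] at this
    rw [hval]
    have hiff : ∀ x : Σ i : Fin d, Fin (blockSize D ρ i),
        (letterEquiv m ρ hρ ⟨x.1, subIdx D ρ x.1 x.2⟩ : Fin m) = j ↔
          (⟨x.1, subIdx D ρ x.1 x.2⟩ : Σ i : Fin d, Fin (freq ρ (i.1 + 1))) = ⟨i₀, r₀⟩ := by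
      intro x
      rw [← (letterEquiv m ρ hρ).injective.eq_iff, hx₀, ← Subtype.coe_inj]
    simp_rw [hiff]
    -- count: positions `(i₀, p)` with `subIdx p = r₀`
    have hset2 : (Finset.univ.filter fun x : Σ i : Fin d, Fin (blockSize D ρ i) =>
        (⟨x.1, subIdx D ρ x.1 x.2⟩ : Σ i : Fin d, Fin (freq ρ (i.1 + 1))) = ⟨i₀, r₀⟩) =
        (Finset.univ.filter fun p : Fin (blockSize D ρ i₀) => subIdx D ρ i₀ p = r₀).map
          (Function.Embedding.sigmaMk i₀) := by
      ext x
      simp only [Finset.mem_filter, Finset.mem_univ, true_and, Finset.mem_map,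
        Function.Embedding.sigmaMk_apply]
      constructor
      · intro h
        obtain ⟨i, p⟩ := x
        obtain ⟨rfl, h2⟩ := Sigma.mk.inj_iff.mp h
        exact ⟨p, eq_of_heq h2, rfl⟩
      · rintro ⟨p, hp, rfl⟩
        exact Sigma.ext rfl (heq_of_eq hp)
    rw [hset2, Finset.card_map, card_filter_subIdx_eq, mul_comm]

end BlockWord

/-! ### The stabilizer of the block word is `ψ(∏ᵢ Kᵢ)` -/

section Stabilizer

variable {d : ℕ} (m D : ℕ) (ρ : Nat.Partition d) (hρ : ρ.parts.card ≤ m)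

/-- A relabelling `σ` with `σ ∘ w₀ ∘ τ = w₀` (some `τ`) preserves `ϱ`: `ϱ_{σ⁻¹ j} = ϱ_j`
(contents agree, and `content(w₀) = D·ϱ̂` with `D ≠ 0`). [cite: IkenmeyerKandasamy2019, §10 (proof of Prop. 10.1)] -/
theorem getD_perm_symm_eq_of_comp_blockWord (hD : 0 < D) {σ : Equiv.Perm (Fin m)}
    {τ : Equiv.Perm (Fin (∑ j, blockSize D ρ j))}
    (h : ⇑σ ∘ blockWord m D ρ hρ ∘ ⇑τ = blockWord m D ρ hρ) (j : Fin m) :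
    ρ.sortedParts.getD (σ.symm j) 0 = ρ.sortedParts.getD j 0 := by
  have hc := congr_fun (congrArg wordContent h) j
  have h1 : wordContent (⇑σ ∘ blockWord m D ρ hρ ∘ ⇑τ) j =
      wordContent (blockWord m D ρ hρ) (σ.symm j) := by
    rw [show (⇑σ ∘ blockWord m D ρ hρ ∘ ⇑τ) = ⇑σ ∘ (blockWord m D ρ hρ ∘ ⇑τ) from rfl]
    unfold wordContent
    rw [← wordContent, ← wordContent]
    have : (Finset.univ.filter fun p => (⇑σ ∘ (blockWord m D ρ hρ ∘ ⇑τ)) p = j) =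
        Finset.univ.filter fun p => (blockWord m D ρ hρ ∘ ⇑τ) p = σ.symm j := by
      ext p
      simp only [Finset.mem_filter, Finset.mem_univ, true_and, Function.comp_apply,
        Equiv.apply_eq_iff_eq_symm_apply]
    change (Finset.univ.filter fun p => (⇑σ ∘ (blockWord m D ρ hρ ∘ ⇑τ)) p = j).card = _
    rw [this]
    exact wordContent_comp_perm (blockWord m D ρ hρ) τ (σ.symm j)
  rw [h1, wordContent_blockWord] at hc
  simp only at hc
  exact Nat.eq_of_mul_eq_mul_left hD hc

/-- **`K_{Dϱ}(w₀) = ψ(∏ᵢ 𝔖_{ρ̂_{i+1}} ≀ 𝔖_{(i+1)D})`**: a permutation `τ` of the positions admits a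
relabelling `σ ∈ 𝔖_m` with `σ ∘ w₀ ∘ τ = w₀` iff `τ = ψ(y)` for a tuple `y` of block permutations each
mapping sub-blocks to sub-blocks (`yᵢ ∈ Kᵢ`). IK §10: "the stabilizer of `Dϱ` … is
`∏ᵢ 𝔖_{ρ̂ᵢ} ≀ 𝔖_{iD}`" (`0 < D`, `ℓ(ϱ) ≤ m`). [cite: IkenmeyerKandasamy2019, §10 (proof of Prop. 10.1)] -/
theorem exists_perm_comp_blockWord_iff (hD : 0 < D) (τ : Equiv.Perm (Fin (∑ j, blockSize D ρ j))) :
    (∃ σ : Equiv.Perm (Fin m), ⇑σ ∘ blockWord m D ρ hρ ∘ ⇑τ = blockWord m D ρ hρ) ↔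
      ∃ y : ∀ i, Equiv.Perm (Fin (blockSize D ρ i)), (∀ i, y i ∈ blockSubgroup D ρ i) ∧
        ((Equiv.permCongrHom (finSigmaFinEquiv (n := blockSize D ρ))).toMonoidHom.comp
          (Equiv.Perm.sigmaCongrRightHom fun j => Fin (blockSize D ρ j))) y = τ := by
  classical
  set Λ := letterEquiv m ρ hρ with hΛ
  constructor
  · rintro ⟨σ, hσ⟩
    have hστ : ∀ q, σ (blockWord m D ρ hρ (τ q)) = blockWord m D ρ hρ q := fun q => congr_fun hσ q
    -- Step A: `τ` preserves the blocks, hence `τ = ψ y`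
    have hblk : ∀ q, (finSigmaFinEquiv.symm (τ q)).1 = (finSigmaFinEquiv.symm q).1 := by
      intro q
      obtain ⟨⟨i, p⟩, rfl⟩ := (finSigmaFinEquiv (n := blockSize D ρ)).surjective q
      obtain ⟨⟨i', p'⟩, hq'⟩ := (finSigmaFinEquiv (n := blockSize D ρ)).surjective (τ (finSigmaFinEquiv ⟨i, p⟩))
      rw [← hq', Equiv.symm_apply_apply, Equiv.symm_apply_apply]
      have h1 := hστ (finSigmaFinEquiv ⟨i, p⟩)
      rw [← hq', Equiv.apply_eq_iff_eq_symm_apply] at h1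
      have h2 := getD_blockWord m D ρ hρ i' p'
      rw [h1, getD_perm_symm_eq_of_comp_blockWord m D ρ hρ hD hσ, getD_blockWord] at h2
      change i' = i
      exact Fin.ext (by omega)
    obtain ⟨y, hy⟩ := (mem_range_youngEmbedding_iff (blockSize D ρ) τ).mpr hblk
    refine ⟨y, fun i => ?_, hy⟩
    -- Step B: each `y i` maps sub-blocks to sub-blocks
    rw [mem_blockSubgroup_iff]
    have key : ∀ p : Fin (blockSize D ρ i),
        (Λ ⟨i, subIdx D ρ i (y i p)⟩ : Fin m) = σ.symm (Λ ⟨i, subIdx D ρ i p⟩) := by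
      intro p
      have h1 := hστ (finSigmaFinEquiv ⟨i, p⟩)
      rw [← hy, youngEmbedding_apply_finSigmaFinEquiv, blockWord_apply, blockWord_apply,
        Equiv.apply_eq_iff_eq_symm_apply] at h1
      exact h1
    intro p p'
    have e1 : subIdx D ρ i (y i p) = subIdx D ρ i (y i p') ↔
        (Λ ⟨i, subIdx D ρ i (y i p)⟩ : Fin m) = Λ ⟨i, subIdx D ρ i (y i p')⟩ := by
      rw [Subtype.coe_inj, Λ.injective.eq_iff, Sigma.mk.inj_iff]
      simp
    have e2 : subIdx D ρ i p = subIdx D ρ i p' ↔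
        (Λ ⟨i, subIdx D ρ i p⟩ : Fin m) = Λ ⟨i, subIdx D ρ i p'⟩ := by
      rw [Subtype.coe_inj, Λ.injective.eq_iff, Sigma.mk.inj_iff]
      simp
    rw [e1, e2, key, key, σ.symm.injective.eq_iff]
  · rintro ⟨y, hy, rfl⟩
    -- the induced permutation of the sub-blocks, as a permutation of the letters with `ϱ ≠ 0`
    have hwd : ∀ i (p : Fin (blockSize D ρ i)),
        subIdx D ρ i (y i p) = subIdx D ρ i (y i (subRep D ρ hD i (subIdx D ρ i p))) := by
      intro i p
      exact ((mem_blockSubgroup_iff D ρ i (y i)).mp (hy i) p _).mpr (by rw [subIdx_subRep])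
    let θ : (Σ i : Fin d, Fin (freq ρ (i.1 + 1))) → Σ i : Fin d, Fin (freq ρ (i.1 + 1)) :=
      fun x => ⟨x.1, subIdx D ρ x.1 (y x.1 (subRep D ρ hD x.1 x.2))⟩
    have hθ : Function.Injective θ := by
      rintro ⟨i, r⟩ ⟨i', r'⟩ h
      simp only [θ, Sigma.mk.inj_iff] at h
      obtain ⟨hii', h2⟩ := h
      subst hii'
      have h3 := eq_of_heq h2
      have h4 := ((mem_blockSubgroup_iff D ρ i (y i)).mp (hy i) _ _).mp h3
      rw [subIdx_subRep, subIdx_subRep] at h4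
      rw [h4]
    let θe : Equiv.Perm (Σ i : Fin d, Fin (freq ρ (i.1 + 1))) :=
      Equiv.ofBijective θ (Finite.injective_iff_bijective.mp hθ)
    refine ⟨(θe.extendDomain Λ)⁻¹, funext fun q => ?_⟩
    obtain ⟨⟨i, p⟩, rfl⟩ := (finSigmaFinEquiv (n := blockSize D ρ)).surjective q
    simp only [Function.comp_apply]
    rw [youngEmbedding_apply_finSigmaFinEquiv, blockWord_apply, blockWord_apply, Equiv.Perm.inv_def,
      Equiv.symm_apply_eq, hwd]
    change _ = θe.extendDomain Λ (Λ ⟨i, subIdx D ρ i p⟩)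
    rw [Equiv.Perm.extendDomain_apply_image]
    rfl

/-- **(W1) The block word of content `D·ϱ̂` and its stabilizer**, packaged for the assembly of
`IK2020_prop_10_1` (`IK2020_prop_10_1_of_finrank_invariants_eq_bCoeff`): for `0 < D` and
`ℓ(ϱ) ≤ m` there is a word `w₀` on `Fin (∑ᵢ nᵢ)`, `nᵢ = D·(i+1)·ρ̂_{i+1}`, with
`content(w₀) = D·ϱ̂` and `{τ | ∃ σ, σ ∘ w₀ ∘ τ = w₀} = ψ(∏ᵢ Kᵢ)`, `Kᵢ = 𝔖_{ρ̂_{i+1}} ≀ 𝔖_{(i+1)D}`.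
[cite: IkenmeyerKandasamy2019, §10 (proof of Prop. 10.1)] -/
theorem exists_blockWord (hD : 0 < D) (hρm : ρ.parts.card ≤ m) :
    ∃ w₀ : Word m (∑ j, (fun i : Fin d => D * (i.1 + 1) * freq ρ (i.1 + 1)) j),
      (wordContent w₀ = fun i : Fin m => D * ρ.sortedParts.getD i 0) ∧
      ∀ τ : Equiv.Perm (Fin (∑ j, (fun i : Fin d => D * (i.1 + 1) * freq ρ (i.1 + 1)) j)),
        (∃ σ : Equiv.Perm (Fin m), ⇑σ ∘ w₀ ∘ ⇑τ = w₀) ↔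
        ∃ y : ∀ i, Equiv.Perm (Fin ((fun i : Fin d => D * (i.1 + 1) * freq ρ (i.1 + 1)) i)),
          (∀ i, y i ∈ blockSubgroup D ρ i) ∧
          ((Equiv.permCongrHom
              (finSigmaFinEquiv (n := fun i : Fin d => D * (i.1 + 1) * freq ρ (i.1 + 1)))).toMonoidHom.comp
            (Equiv.Perm.sigmaCongrRightHom fun j =>
              Fin ((fun i : Fin d => D * (i.1 + 1) * freq ρ (i.1 + 1)) j))) y = τ :=
  ⟨blockWord m D ρ hρm, wordContent_blockWord m D ρ hρm, exists_perm_comp_blockWord_iff m D ρ hρm hD⟩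

end Stabilizer

/-! ### (W2) for the block subgroups: `|Kᵢ|⁻¹ ∑_{Kᵢ} χ^μ = a_μ(ρ̂_{i+1}, (i+1)D)` -/

section BlockAverage

variable {d : ℕ} (N D : ℕ) (ρ : Nat.Partition d)

/-- Transport of the wreath-product character sum along `finCongr` (cast-free: the target size is
a variable `a` with `f * M = a`; any `Fintype` instance on the subgroup). [folklore] -/
private theorem sum_map_permCongrHom_spechtCharacter {f M a : ℕ} (h : f * M = a) (hM : M ≠ 0)
    (μ : Nat.Partition a) (hμ : μ.parts.card ≤ N)
    [Fintype ↥((blockPerms f M).map (Equiv.permCongrHom (finCongr h)).toMonoidHom)] :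
    (Nat.card ↥((blockPerms f M).map (Equiv.permCongrHom (finCongr h)).toMonoidHom) : ℂ)⁻¹ *
        ∑ s : ↥((blockPerms f M).map (Equiv.permCongrHom (finCongr h)).toMonoidHom),
          spechtCharacter ℂ μ (s : Equiv.Perm (Fin a)) =
      (plethysmCoeffOfPartition ℂ N M μ : ℂ) := by
  subst h
  have hφ : ∀ κ : Equiv.Perm (Fin (f * M)),
      (Equiv.permCongrHom (finCongr (rfl : f * M = f * M))).toMonoidHom κ = κ := by
    intro κ
    rw [finCongr_refl]
    rfl
  let e : ↥(blockPerms f M) ≃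
      ↥((blockPerms f M).map (Equiv.permCongrHom (finCongr (rfl : f * M = f * M))).toMonoidHom) :=
    ((blockPerms f M).equivMapOfInjective _
      (Equiv.permCongrHom (finCongr (rfl : f * M = f * M))).injective).toEquiv
  rw [Nat.card_congr e.symm, inv_mul_eq_iff_eq_mul₀
    (Nat.cast_ne_zero.mpr (Nat.card_pos (α := ↥(blockPerms f M))).ne'),
    ← sum_blockPerms_spechtCharacter_eq ℂ N hM μ hμ]
  exact (Fintype.sum_equiv e _ _ fun κ => by
    change spechtCharacter ℂ μ (κ : Equiv.Perm (Fin (f * M))) =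
      spechtCharacter ℂ μ (((blockPerms f M).equivMapOfInjective _
        (Equiv.permCongrHom (finCongr (rfl : f * M = f * M))).injective κ :
          ↥((blockPerms f M).map (Equiv.permCongrHom (finCongr (rfl : f * M = f * M))).toMonoidHom)) :
        Equiv.Perm (Fin (f * M)))
    rw [Subgroup.coe_equivMapOfInjective_apply, hφ]).symm

/-- **(W2) for `Kᵢ`**: `|Kᵢ|⁻¹ · ∑_{s ∈ Kᵢ} χ^μ(s) = a_μ(ρ̂_{i+1}, (i+1)·D)` — the average of a Specht
character over the block subgroup is the plethysm coefficient `plethysmCoeffOfPartition ℂ N ((i+1)·D) μ`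
(`μ ⊢ nᵢ` with at most `N` parts, `0 < D`). [cite: IkenmeyerKandasamy2019, §10 (proof of Prop. 10.1)] -/
theorem card_inv_mul_sum_blockSubgroup_spechtCharacter (hD : 0 < D) (i : Fin d)
    (μ : Nat.Partition (blockSize D ρ i)) (hμ : μ.parts.card ≤ N) [Fintype ↥(blockSubgroup D ρ i)] :
    (Nat.card ↥(blockSubgroup D ρ i) : ℂ)⁻¹ *
        ∑ s : ↥(blockSubgroup D ρ i), spechtCharacter ℂ μ (s : Equiv.Perm (Fin (blockSize D ρ i))) =
      (plethysmCoeffOfPartition ℂ N ((i.1 + 1) * D) μ : ℂ) :=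
  sum_map_permCongrHom_spechtCharacter N (freq_mul_eq_blockSize D ρ i)
    (Nat.mul_ne_zero (Nat.succ_ne_zero _) hD.ne') μ hμ

end BlockAverage

end IK2020

/-! ### The discharge: `IK2020_prop_10_1_holds`, `IK2020_prop_4_1_holds` -/

open IK2020 in
/-- **Ikenmeyer–Kandasamy 2020, Prop. 10.1 — DISCHARGED** (`theorem IK2020_prop_10_1_holds :
IK2020_prop_10_1`): "`dim ({λ}^{Dϱ})^{𝔖_m} = b(λ, ϱ, D, d)`". Assembled by t02's closer
`IK2020_prop_10_1_of_blockWord` (`IK2020Prop101Holds.lean`: the Young-subgroup branching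
`YoungSubgroupBranching.lean`, t01's `MultiYoungSymmetrizerRank` / `YoungSubgroupCharacterSum` /
`MultiLRCoeffVanishing`, t08's `YoungWreathSliceCharacter`, the transport `IK2020ContentSliceTransport`)
from this file's word side: the block subgroups `Kᵢ` (W2: `card_inv_mul_sum_blockSubgroup_spechtCharacter`)
and the block word (W1: `exists_blockWord`). [cite: IkenmeyerKandasamy2019, Prop. 10.1] -/
theorem IK2020_prop_10_1_holds : IK2020_prop_10_1 :=
  IK2020_prop_10_1_of_blockWord (fun _ D _ ρ i => blockSubgroup D ρ i)
    (fun m D _ ρ hD i μ hμ => card_inv_mul_sum_blockSubgroup_spechtCharacter m D ρ hD i μ hμ)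
    (fun m D _ ρ hD hρ => exists_blockWord m D ρ hD hρ)

open IK2020 in
/-- **Ikenmeyer–Kandasamy 2020, Prop. 4.1 — DISCHARGED** (`theorem IK2020_prop_4_1_holds :
IK2020_prop_4_1`, the multiplicity formula `mult_{λ^*} ℂ[Gp] = b(λ, ϱ, D, d)` for the power sum),
by the tree's reduction `IK2020_prop_4_1_of_prop_10_1` (`IK2020PowerSumInvariantsDecompositionProofs`)
as packaged in `IK2020_prop_4_1_of_blockWord`. [cite: IkenmeyerKandasamy2019, Prop. 4.1] -/
theorem IK2020_prop_4_1_holds : IK2020_prop_4_1 :=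
  IK2020_prop_4_1_of_prop_10_1 IK2020_prop_10_1_holds

end Literature.Computability.AlgebraicComplexity

end
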